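import Literature.NumberTheory.GaloisRepresentations.ChebotarevCyclicProofs
import Literature.NumberTheory.LFunctions.ChebotarevCyclicCosetCount
import HarnessLib

/-!
# Galois bookkeeping for the density form of Chebotarev's crossing argument

Topic `Literature/NumberTheory/GaloisRepresentations`; theorems only (no `sorry`, no new
definition, no named fact).  Companion of the tree's `ChebotarevCyclicProofs.lean` (Chebotarev's
"crossing with a cyclotomic extension" in EXISTENCE form, where ONE auxiliary lift suffices):
the density form of the argument (Stevenhagen–Lenstra, *Chebotarëv and his density theorem*,
Math. Intelligencer 18 (1996), "Chebotarëv's proof"; N. Tschebotareff, Math. Ann. 95 (1926))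
needs ALL the lifts `h ∈ Gal(N/M)` of a given `σ ∈ Gal(L/M)`, `N = L(ζ_ℓ)`, whose cyclotomic
character `χ(h)` has order divisible by `n = ord σ`, and the sizes of their conjugacy classes.

Setting (as in `ChebotarevCyclicProofs.lean`): `M ⊆ L ⊆ N` fields, `L/M` Galois,
`IsCyclotomicExtension {ℓ} L N` with `ℓ` prime, `ζ ∈ N` a primitive `ℓ`-th root of unity,
`χ = hζ.autToPow M : Gal(N/M) → (ℤ/ℓ)ˣ` (Mathlib `IsPrimitiveRoot.autToPow`), `res =
AlgEquiv.restrictNormalHom L : Gal(N/M) → Gal(L/M)`.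

* `autToPow_restrictScalars`, `restrictNormalHom_restrictScalars`,
  `exists_restrictScalars_eq_of_restrictNormalHom_eq_one` — `Gal(N/L) → Gal(N/M)`
  (`AlgEquiv.restrictScalars`) is compatible with `χ`, lands in `ker res`, and exhausts it.
* `eq_one_of_restrictNormalHom_eq_one_of_autToPow_eq_one`, `eq_of_restrictNormalHom_eq_of_autToPow_eq`
  — **`(res, χ)` is injective** on `Gal(N/M)` (`χ` is injective on `Gal(N/L)`,
  `IsPrimitiveRoot.autToPow_injective`).
* `card_aut_eq_card_aut_mul_finrank` — `#Gal(N/M) = #Gal(L/M) · [N:L]`;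
  `restrictScalars_mul_comm` — **`Gal(N/L)` is central in `Gal(N/M)`**.
* `card_setOf_isConj_eq` — **the conjugacy class of `h` in `Gal(N/M)` is in bijection (via `res`)
  with that of `res h` in `Gal(L/M)`** (`χ` is constant on classes).
* `pow_eq_one_of_autToPow_pow_eq_one`, `orderOf_eq_orderOf_autToPow` — **admissible lifts**: if
  `ord (res h) ∣ ord χ(h)` then `χ` is injective on `⟨h⟩` (the hypothesis of
  `isCyclotomicExtension_fixedField_zpowers`: `N = F(ζ_ℓ)` for `F = N^{⟨h⟩}`) and
  `ord h = ord χ(h)`.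
* `le_card_admissible_lifts` — **if `nᵏ ∣ [N:L]` (`n = ord σ`, `k ≥ 1`) then at least
  `(1 - n/2ᵏ)·[N:L]` lifts `h` of `σ` are admissible**: the lifts are `h₀ · e`, `e ∈ Gal(N/L)`,
  with `χ(h₀ e) = χ(h₀) χ_L(e)` running over a coset of `χ_L(Gal(N/L)) ≤ (ℤ/ℓ)ˣ`
  (`Literature.NumberTheory.LFunctions.Chebotarev.le_card_filter_dvd_orderOf_coset`).
* `isArithFrobAt_under_restrictNormalHom` — `res` maps an arithmetic Frobenius of `N/M` at `𝔑`
  to an arithmetic Frobenius of `L/M` at `𝔑 ∩ 𝓞 L` (the step "its restriction `g` a Frobenius of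
  `L/M`" of `ChebotarevCyclicProofs.infinite_setOf_frobenius_eq_of_isCyclic`, isolated).

## References

* P. Stevenhagen, H. W. Lenstra, *Chebotarëv and his density theorem*, Math. Intelligencer 18
  (1996), no. 2, 26–37 ("Chebotarëv's proof"). [StevenhagenLenstra1996]
* H. Hasse, *History of class field theory*, Ch. XI of Cassels–Fröhlich (1967), p. 273.
  [CasselsFrohlichANT1967]
-/

noncomputable section

open NumberField IsDedekindDomain Polynomial

open scoped Classical

namespace Literature.NumberTheory.GaloisRepresentations

section Crossing

variable {M L : Type} [Field M] [Field L] [Algebra M L]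
variable {N : Type} [Field N] [Algebra L N] [Algebra M N] [IsScalarTower M L N]

/-- The cyclotomic character of `Gal(N/M)` restricted along `Gal(N/L) → Gal(N/M)`
(`AlgEquiv.restrictScalars`) is the cyclotomic character of `Gal(N/L)` (both record the exponent
`a` with `σ ζ = ζᵃ`, Mathlib `IsPrimitiveRoot.autToPow_spec`). [folklore] -/
theorem autToPow_restrictScalars {ℓ : ℕ} [NeZero ℓ] {ζ : N} (hζ : IsPrimitiveRoot ζ ℓ)
    (e : N ≃ₐ[L] N) : hζ.autToPow M (e.restrictScalars M) = hζ.autToPow L e := by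
  apply Units.ext
  apply ZMod.val_injective ℓ
  apply hζ.pow_inj (ZMod.val_lt _) (ZMod.val_lt _)
  rw [hζ.autToPow_spec M (e.restrictScalars M), hζ.autToPow_spec L e]
  rfl

variable [IsGalois M L]

/-- An `L`-automorphism of `N` restricts to the identity of `L`: `res ∘ (Gal(N/L) → Gal(N/M)) = 1`.
[folklore] -/
theorem restrictNormalHom_restrictScalars (e : N ≃ₐ[L] N) :
    AlgEquiv.restrictNormalHom L (e.restrictScalars M) = 1 := by
  ext x
  apply (algebraMap L N).injective
  rw [show AlgEquiv.restrictNormalHom L (e.restrictScalars M) = (e.restrictScalars M).restrictNormal L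
      from rfl, AlgEquiv.restrictNormal_commutes, AlgEquiv.one_apply]
  exact e.commutes x

/-- An `M`-automorphism of `N` restricting to the identity of `L` is (the image of) an
`L`-automorphism: `ker res ⊆ Gal(N/L)`. [folklore] -/
theorem exists_restrictScalars_eq_of_restrictNormalHom_eq_one (σ : N ≃ₐ[M] N)
    (hσ : AlgEquiv.restrictNormalHom L σ = 1) : ∃ e : N ≃ₐ[L] N, e.restrictScalars M = σ := by
  have hfix : ∀ x : L, σ (algebraMap L N x) = algebraMap L N x := by
    intro x
    rw [← AlgEquiv.restrictNormal_commutes σ L x,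
      show σ.restrictNormal L = AlgEquiv.restrictNormalHom L σ from rfl, hσ, AlgEquiv.one_apply]
  exact ⟨AlgEquiv.ofRingEquiv (f := (σ : N ≃+* N)) hfix, by ext x; rfl⟩

variable {ℓ : ℕ} [Fact ℓ.Prime] [IsCyclotomicExtension {ℓ} L N] {ζ : N} (hζ : IsPrimitiveRoot ζ ℓ)

include hζ in
/-- **Joint injectivity of `(res, χ)`**: an `M`-automorphism of `N = L(ζ_ℓ)` trivial on `L` and
on `ζ_ℓ` is trivial (`ker res ⊆ Gal(N/L)`, on which `χ` is injective, Mathlib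
`IsPrimitiveRoot.autToPow_injective`).  This is `hjoint` of
`ChebotarevCyclicProofs.exists_lift_autToPow_pow_injective`, isolated. [folklore] -/
theorem eq_one_of_restrictNormalHom_eq_one_of_autToPow_eq_one (σ : N ≃ₐ[M] N)
    (h1 : AlgEquiv.restrictNormalHom L σ = 1) (h2 : hζ.autToPow M σ = 1) : σ = 1 := by
  haveI : NeZero ℓ := ⟨(Fact.out : ℓ.Prime).ne_zero⟩
  obtain ⟨e, rfl⟩ := exists_restrictScalars_eq_of_restrictNormalHom_eq_one σ h1
  rw [autToPow_restrictScalars hζ] at h2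
  have he : e = 1 := hζ.autToPow_injective (K := L) (by rw [h2, map_one])
  rw [he]
  rfl

include hζ in
/-- `σ ∈ Gal(N/M)` is determined by `(σ|_L, χ(σ))`: `Gal(N/M) ↪ Gal(L/M) × (ℤ/ℓ)ˣ`. [folklore] -/
theorem eq_of_restrictNormalHom_eq_of_autToPow_eq {σ τ : N ≃ₐ[M] N}
    (h1 : AlgEquiv.restrictNormalHom L σ = AlgEquiv.restrictNormalHom L τ)
    (h2 : hζ.autToPow M σ = hζ.autToPow M τ) : σ = τ := by
  have := eq_one_of_restrictNormalHom_eq_one_of_autToPow_eq_one hζ (σ * τ⁻¹)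
    (by rw [map_mul, map_inv, h1, mul_inv_cancel]) (by rw [map_mul, map_inv, h2, mul_inv_cancel])
  exact mul_inv_eq_one.mp this

omit [IsGalois M L] [Fact ℓ.Prime] [IsCyclotomicExtension {ℓ} L N] in
/-- `#Gal(N/M) = #Gal(L/M) · [N : L]` (tower law). [folklore] -/
theorem card_aut_eq_card_aut_mul_finrank [FiniteDimensional M L] [FiniteDimensional L N]
    [IsGalois M L] [IsGalois M N] :
    Nat.card (N ≃ₐ[M] N) = Nat.card (L ≃ₐ[M] L) * Module.finrank L N := by
  haveI : FiniteDimensional M N := Module.Finite.trans L N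
  rw [IsGalois.card_aut_eq_finrank, IsGalois.card_aut_eq_finrank, Module.finrank_mul_finrank]

include hζ in
/-- **`Gal(N/L)` is central in `Gal(N/M)`**: for `e ∈ Gal(N/L)` and `g ∈ Gal(N/M)`, `g e = e g`
(both sides have the same restriction `res g` to `L` and the same cyclotomic character).
[folklore] -/
theorem restrictScalars_mul_comm (e : N ≃ₐ[L] N) (g : N ≃ₐ[M] N) :
    g * e.restrictScalars M = e.restrictScalars M * g := by
  refine eq_of_restrictNormalHom_eq_of_autToPow_eq (L := L) hζ ?_ ?_
  · rw [map_mul, map_mul, restrictNormalHom_restrictScalars, mul_one, one_mul]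
  · rw [map_mul, map_mul, mul_comm]

include hζ in
/-- **Conjugacy classes of `Gal(N/M)` biject onto those of `Gal(L/M)`**: for `h ∈ Gal(N/M)`,
`res` is a bijection from `{τ : τ ∼ h}` onto `{σ' : σ' ∼ res h}` (injective because `χ` is
constant on a class and `(res, χ)` is injective; surjective because `res` is,
Mathlib `AlgEquiv.restrictNormalHom_surjective`); in particular `#⟨h⟩ = #⟨res h⟩`. [folklore] -/
theorem card_setOf_isConj_eq [IsGalois M N] (h : N ≃ₐ[M] N) :
    Nat.card {τ : N ≃ₐ[M] N | IsConj h τ} =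
      Nat.card {σ' : L ≃ₐ[M] L | IsConj (AlgEquiv.restrictNormalHom L h) σ'} := by
  set res : (N ≃ₐ[M] N) →* (L ≃ₐ[M] L) := AlgEquiv.restrictNormalHom L with hresdef
  have hχconj : ∀ {τ : N ≃ₐ[M] N}, IsConj h τ → hζ.autToPow M τ = hζ.autToPow M h := by
    intro τ hτ
    obtain ⟨x, rfl⟩ := isConj_iff.mp hτ
    rw [map_mul, map_mul, map_inv, mul_inv_eq_iff_eq_mul, mul_comm]
  have hmap : ∀ τ : {τ : N ≃ₐ[M] N | IsConj h τ}, IsConj (res h) (res τ.1) := by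
    intro τ
    obtain ⟨x, hx⟩ := isConj_iff.mp τ.2
    exact isConj_iff.mpr ⟨res x, by rw [← map_mul, ← map_inv, ← map_mul, hx]⟩
  set Φ : {τ : N ≃ₐ[M] N | IsConj h τ} → {σ' : L ≃ₐ[M] L | IsConj (res h) σ'} :=
    fun τ ↦ ⟨res τ.1, hmap τ⟩ with hΦ
  have hinj : Function.Injective Φ := by
    intro τ₁ τ₂ heq
    have h1 : res τ₁.1 = res τ₂.1 := congrArg Subtype.val heq
    exact Subtype.ext (eq_of_restrictNormalHom_eq_of_autToPow_eq hζ h1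
      ((hχconj τ₁.2).trans (hχconj τ₂.2).symm))
  have hsurj : Function.Surjective Φ := by
    rintro ⟨σ', hσ'⟩
    obtain ⟨ybar, rfl⟩ := isConj_iff.mp hσ'
    obtain ⟨y, rfl⟩ := AlgEquiv.restrictNormalHom_surjective (F := M) (E := N) (K₁ := L) ybar
    refine ⟨⟨y * h * y⁻¹, isConj_iff.mpr ⟨y, rfl⟩⟩, Subtype.ext ?_⟩
    simp only [hΦ, map_mul, map_inv]
    rfl
  exact Nat.card_eq_of_bijective Φ ⟨hinj, hsurj⟩

include hζ in
/-- **Admissible lifts.** If `ord (res h) ∣ ord χ(h)` then `χ` is injective on `⟨h⟩`: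
`χ(hʲ) = 1 ⇒ hʲ = 1` (then `ord χ(h) ∣ j`, so `res hʲ = 1` as well) — the hypothesis of
`isCyclotomicExtension_fixedField_zpowers` (`N = F(ζ_ℓ)` over `F = N^{⟨h⟩}`). [folklore] -/
theorem pow_eq_one_of_autToPow_pow_eq_one {h : N ≃ₐ[M] N}
    (hord : orderOf (AlgEquiv.restrictNormalHom L h) ∣ orderOf (hζ.autToPow M h)) (j : ℕ)
    (hj : hζ.autToPow M (h ^ j) = 1) : h ^ j = 1 := by
  refine eq_one_of_restrictNormalHom_eq_one_of_autToPow_eq_one (L := L) hζ (h ^ j) ?_ hj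
  rw [map_pow]
  rw [map_pow] at hj
  have h1 : orderOf (hζ.autToPow M h) ∣ j := orderOf_dvd_of_pow_eq_one hj
  exact orderOf_dvd_iff_pow_eq_one.mp (hord.trans h1)

include hζ in
/-- For an admissible lift `h` (`ord (res h) ∣ ord χ(h)`), `ord h = ord χ(h)`. [folklore] -/
theorem orderOf_eq_orderOf_autToPow {h : N ≃ₐ[M] N}
    (hord : orderOf (AlgEquiv.restrictNormalHom L h) ∣ orderOf (hζ.autToPow M h)) :
    orderOf h = orderOf (hζ.autToPow M h) := by
  refine Nat.dvd_antisymm (orderOf_dvd_of_pow_eq_one ?_) (orderOf_map_dvd _ h)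
  exact pow_eq_one_of_autToPow_pow_eq_one hζ hord _ (by rw [map_pow]; exact pow_orderOf_eq_one _)

include hζ in
/-- **Many admissible lifts.** Let `σ ∈ Gal(L/M)` have order `n` and suppose `nᵏ ∣ [N : L]`
with `k ≥ 1`.  Then at least `(1 - n/2ᵏ) · [N : L]` of the `[N : L]` lifts `h ∈ Gal(N/M)` of `σ`
satisfy `n ∣ ord χ(h)`: the lifts are `h₀ e`, `e ∈ Gal(N/L)`, and `χ(h₀ e) = χ(h₀) · χ_L(e)` runs
over the coset `χ(h₀) · W` of `W = χ_L(Gal(N/L))`, a subgroup of order `[N:L]` of the cyclic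
group `(ℤ/ℓ)ˣ` (`Literature.NumberTheory.LFunctions.Chebotarev.le_card_filter_dvd_orderOf_coset`).  (In Chebotarev's
proof these `h` index the auxiliary classes for which `N` is a cyclotomic extension of the fixed
field of `h`.) [cite: StevenhagenLenstra1996, §"Chebotarëv's proof"] -/
theorem le_card_admissible_lifts [NumberField M] [NumberField L] [NumberField N] [IsGalois M N]
    (σ : L ≃ₐ[M] L) {k : ℕ} (hk0 : 0 < k) (hk : orderOf σ ^ k ∣ Module.finrank L N) :
    (1 - (orderOf σ : ℝ) / 2 ^ k) * Module.finrank L N ≤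
      Nat.card {h : N ≃ₐ[M] N // AlgEquiv.restrictNormalHom L h = σ ∧
        orderOf σ ∣ orderOf (hζ.autToPow M h)} := by
  haveI : NeZero ℓ := ⟨(Fact.out : ℓ.Prime).ne_zero⟩
  haveI : IsGalois L N := IsCyclotomicExtension.isGalois {ℓ} L N
  haveI : FiniteDimensional M N := Module.Finite.trans L N
  set res : (N ≃ₐ[M] N) →* (L ≃ₐ[M] L) := AlgEquiv.restrictNormalHom L with hresdef
  set χ : (N ≃ₐ[M] N) →* (ZMod ℓ)ˣ := hζ.autToPow M with hχdef
  set χL : (N ≃ₐ[L] N) →* (ZMod ℓ)ˣ := hζ.autToPow L with hχLdef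
  have hχL : Function.Injective χL := hζ.autToPow_injective (K := L)
  obtain ⟨W, hWdef⟩ : ∃ W : Subgroup (ZMod ℓ)ˣ, W = χL.range := ⟨_, rfl⟩
  have hW : Nat.card W = Module.finrank L N := by
    rw [hWdef, ← Nat.card_congr (MonoidHom.ofInjective hχL).toEquiv, IsGalois.card_aut_eq_finrank]
  have hmemW : ∀ e : N ≃ₐ[L] N, χL e ∈ W := fun e ↦ hWdef ▸ ⟨e, rfl⟩
  have hWsurj : ∀ w : W, ∃ e : N ≃ₐ[L] N, χL e = w := fun w ↦ by
    have hw : (w : (ZMod ℓ)ˣ) ∈ χL.range := hWdef ▸ w.2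
    exact hw
  set n := orderOf σ with hndef
  have hn : 0 < n := orderOf_pos σ
  -- a lift `h₀` of `σ`
  obtain ⟨h₀, hh₀⟩ := AlgEquiv.restrictNormalHom_surjective (F := M) (E := N) (K₁ := L) σ
  set a₀ : (ZMod ℓ)ˣ := χ h₀ with ha₀
  -- the count in the cyclic group `(ℤ/ℓ)ˣ`
  have hcount : (1 - (n : ℝ) / 2 ^ k) * Module.finrank L N ≤
      Nat.card {w : W // n ∣ orderOf (a₀ * (w : (ZMod ℓ)ˣ))} := by
    have := LFunctions.Chebotarev.le_card_filter_dvd_orderOf_coset (C := (ZMod ℓ)ˣ) W hn hk0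
      (hW ▸ hk) a₀
    rw [hW, ← Fintype.card_subtype, ← Nat.card_eq_fintype_card] at this
    exact this
  refine hcount.trans ?_
  -- inject the good `w = χL e` into the admissible lifts via `e ↦ h₀ * e.restrictScalars M`
  have key : ∀ e : N ≃ₐ[L] N, χ (h₀ * e.restrictScalars M) = a₀ * χL e := by
    intro e
    rw [map_mul, ha₀, hχdef, autToPow_restrictScalars hζ]
  choose lift hlift using hWsurj
  set Ψ : {w : W // n ∣ orderOf (a₀ * (w : (ZMod ℓ)ˣ))} →
      {h : N ≃ₐ[M] N // res h = σ ∧ n ∣ orderOf (χ h)} :=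
    fun w ↦ ⟨h₀ * (lift w.1).restrictScalars M, by
      constructor
      · rw [map_mul, restrictNormalHom_restrictScalars, mul_one]
        exact hh₀
      · rw [key, hlift]
        exact w.2⟩ with hΨ
  have hΨinj : Function.Injective Ψ := by
    intro w₁ w₂ heq
    have h1 := congrArg Subtype.val heq
    simp only [hΨ] at h1
    have h2 := mul_left_cancel h1
    have h3 := AlgEquiv.restrictScalars_injective M h2
    have h4 : (w₁.1 : (ZMod ℓ)ˣ) = w₂.1 := by rw [← hlift w₁.1, ← hlift w₂.1, h3]
    exact Subtype.ext (Subtype.ext h4)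
  have hfin : Finite {h : N ≃ₐ[M] N // res h = σ ∧ n ∣ orderOf (χ h)} := inferInstance
  have hle := Nat.card_le_card_of_injective Ψ hΨinj
  exact_mod_cast hle

omit [Fact ℓ.Prime] [IsCyclotomicExtension {ℓ} L N] in
/-- **Restriction of Frobenius elements**: if `τ ∈ Gal(N/M)` is an arithmetic Frobenius at the
prime `𝔑` of `𝓞 N` (over `𝓞 M`), then `res τ ∈ Gal(L/M)` is an arithmetic Frobenius at
`𝔑 ∩ 𝓞 L` (the inclusion `𝓞 L → 𝓞 N` is `Gal`-equivariant and induces the same residue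
characteristic count `#(𝓞 M / 𝔑 ∩ 𝓞 M)`).  Isolated from the proof of
`ChebotarevCyclicProofs.infinite_setOf_frobenius_eq_of_isCyclic`.
[cite: Marcus2018, Ch. 4, Exercise 11] -/
theorem isArithFrobAt_under_restrictNormalHom {𝔑 : Ideal (𝓞 N)}
    {τ : N ≃ₐ[M] N} (hτ : IsArithFrobAt (𝓞 M) τ 𝔑) :
    IsArithFrobAt (𝓞 M) (AlgEquiv.restrictNormalHom L τ) (𝔑.under (𝓞 L)) := by
  intro x
  rw [Ideal.under_under, MulSemiringAction.toAlgHom_apply, Ideal.under, Ideal.mem_comap, map_sub,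
    map_pow]
  have h1 := hτ (algebraMap (𝓞 L) (𝓞 N) x)
  rw [MulSemiringAction.toAlgHom_apply] at h1
  have h2 : τ • algebraMap (𝓞 L) (𝓞 N) x =
      algebraMap (𝓞 L) (𝓞 N) (AlgEquiv.restrictNormalHom L τ • x) := by
    apply Subtype.ext
    change τ (algebraMap L N (x : L)) = algebraMap L N (AlgEquiv.restrictNormalHom L τ (x : L))
    exact (AlgEquiv.restrictNormal_commutes τ L (x : L)).symm
  rw [h2] at h1
  exact h1

end Crossing

end Literature.NumberTheory.GaloisRepresentations
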